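import Summits.HubbardSuperconductivity.HubbardSuperconductivity.Theorems.AnisotropyChordDoobJohnsonChordSectorBlock
import Summits.HubbardSuperconductivity.HubbardSuperconductivity.Theorems.AnisotropyChordPerronBranchIdentities

/-!
# Route `AnisotropyChord`, crux `ChordXY` (stmt-HubbardSuperconductivity-8146), line `doob-johnson-chord`,
# PLAN A / H1 DISCHARGED: the smooth Perron family of the half-filled sector, the Doob–Hellmann–Feynman
# derivative of the condensate (lead-8146-chordxy g1)

Vocabulary of `…Theorems.AnisotropyChordDoobJohnsonChordDefs` (`Config`, `Hxxz`, `Otot`, `lam`, `IsGS`,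
`ofReal`, `field`).  Results (even `M`; `E_M(u) = lowestEnergyInSector 1 (H_M(u)) 0`):

* `exists_smooth_perronFamily` — **the Perron ground states form a `C^∞` family**: there is
  `Ψ : ℝ → (Config M → ℝ)`, `C^∞` in the anisotropy `u`, with `Ψ u` THE real non-negative normalised
  `S^z_tot = 0` sector ground state of `H_M(u)` (positive on the half-filled configurations, zero off them)
  for EVERY real `u`, and `u ↦ E_M(u)` is `C^∞` (smooth Perron branch of the real sector block,
  `PerronBranch.exists_contDiff_pos_bottom_eigenvector` + `sectorBlock_perronData`);
* `lam_ofReal_eq_dotProduct` — `Λ(ψ) = ψ ⬝ᵥ Oᵣ ψ` for real `ψ`, `Oᵣ = (Re O_{στ})` symmetric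
  (`otot_re_isSymm`); `contDiff_lam_family` — `u ↦ Λ(Ψ u)` is `C^∞` along any `C^∞` family;
* `hasDerivAt_lam_family_doob` — **H1 of the stub plan (Doob–Hellmann–Feynman)**: along a differentiable
  family of real amplitudes that vanishes off the half-filled configurations and is positive on them,
  `d/du Λ(Ψ u) = Σ_σ g_{Ψ u}(σ) · ∂_u (Ψ u σ)² = Σ_σ field M (Ψ u) σ · (2 Ψ u σ Ψ' σ)` — the derivative of
  `Λ = E_{Ψ²}[g]` with the field FROZEN (`Σ_σ Ψ(σ)² ∂_u g(σ) = 0` by symmetry of `O`);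
* (the corollary `chordXY_of_logSlope_smooth` — `ChordXY` from the bare log-slope inequality along such
  families — is in `…DoobJohnsonChordLogSlopeChord`, which adds the `ChordXYRatioAntitone` import).

Folklore / bookkeeping on top of the landed infrastructure; no definition; sorry-free.  HONEST: the
log-slope inequality is NOT proved; nothing here proves `stub_frozenFieldChord` or `ChordXY`;
superconductivity in the Hubbard model is not advanced.
-/

set_option linter.dupNamespace false

noncomputable section

namespace Summit.HubbardSuperconductivity.HubbardSuperconductivity.Theorems.AnisotropyChord.DoobJohnsonChord

open Matrix Finset
open scoped ContDiff
open Literature.MathematicalPhysics.QuantumLattice Literature.Probability.LatticeModels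
open Summit.HubbardSuperconductivity.HubbardSuperconductivity.Theorems.AnisotropyChord
  (condensate_apply_nonneg condensate_apply_symm)
open Summit.HubbardSuperconductivity.HubbardSuperconductivity.Theorems.AnisotropyChord.PerronBranch

variable (M : ℕ) [NeZero M]

/-! ### The smooth Perron family -/

/-- **The Perron ground states of the half-filled sector form a `C^∞` family in the anisotropy.**  For
even `M` there is `Ψ : ℝ → (Config M → ℝ)`, `C^∞`, such that for every real `u`: `Ψ u` is a real
non-negative normalised `S^z_tot = 0` sector ground state of `H_M(u)`, positive on the half-filled
configurations and zero off them; moreover `u ↦ E_M(u)` is `C^∞`.  (Smooth Perron branch of the real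
sector block; Kato (1966) II-§6 for a simple eigenvalue, Perron–Frobenius for the sign.) [folklore] -/
theorem exists_smooth_perronFamily (hM : Even M) :
    ∃ Ψ : ℝ → Config M → ℝ, ContDiff ℝ ∞ Ψ ∧ (∀ u, IsGS M u (ofReal M (Ψ u))) ∧ (∀ u σ, 0 ≤ Ψ u σ) ∧
      (∀ u σ, (∑ z, (σ z : ℕ)) = M ^ 2 / 2 → 0 < Ψ u σ) ∧
      (∀ u σ, (∑ z, (σ z : ℕ)) ≠ M ^ 2 / 2 → Ψ u σ = 0) ∧
      ContDiff ℝ ∞ (fun u => lowestEnergyInSector 1 (Hxxz M u) 0) := by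
  haveI := halfFilled_nonempty M
  -- the smooth Perron branch of the real sector block
  obtain ⟨N, Λ, hN, hΛ, hN1, hTN, hNpos, hgap⟩ :=
    exists_contDiff_pos_bottom_eigenvector
      (T := fun u => Matrix.of fun s t : {σ : Config M // (∑ z, (σ z : ℕ)) = M ^ 2 / 2} =>
        (Hxxz M u s.1 t.1).re)
      (fun s t => sectorBlock_contDiff M s.1 t.1) (fun u => sectorBlock_isSymm M u)
      (fun u => by
        obtain ⟨n, h1, h2, h3, h4⟩ := sectorBlock_perronData M hM u
        exact ⟨n, lowestEnergyInSector 1 (Hxxz M u) 0, h1, h2, h3, h4⟩)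
  -- the branch eigenvalue is the sector energy (positive unit eigenpairs are unique)
  have hΛE : ∀ u, Λ u = lowestEnergyInSector 1 (Hxxz M u) 0 := by
    intro u
    obtain ⟨n, h1, h2, h3, h4⟩ := sectorBlock_perronData M hM u
    exact (pos_eigenvector_unique (sectorBlock_isSymm M u) h1 h2 h3 h4 (hN1 u) (hTN u) (hNpos u)).2
  -- the zero-extension
  refine ⟨fun u σ => if h : (∑ z, (σ z : ℕ)) = M ^ 2 / 2 then N u ⟨σ, h⟩ else 0, ?_, ?_, ?_, ?_, ?_, ?_⟩
  · -- smoothness, coordinatewise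
    refine contDiff_pi.2 fun σ => ?_
    by_cases h : (∑ z, (σ z : ℕ)) = M ^ 2 / 2
    · simp only [dif_pos h]
      exact (contDiff_pi.1 hN) ⟨σ, h⟩
    · simp only [dif_neg h]
      exact contDiff_const
  · -- sector ground state
    intro u
    refine ⟨extend_mem_sector M hM (N u), ?_, ?_⟩
    · rw [star_extend_dotProduct_extend M (N u), hN1 u, Complex.ofReal_one]
    · funext σ
      by_cases hσ : (∑ z, (σ z : ℕ)) = M ^ 2 / 2
      · have h := mulVec_extend_re M u (N u) ⟨σ, hσ⟩
        rw [hTN u] at h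
        rw [h, Pi.smul_apply, Pi.smul_apply, smul_eq_mul, smul_eq_mul, hΛE u]
        simp [ofReal, dif_pos hσ]
      · rw [mulVec_extend_off M hM u (N u) σ hσ, Pi.smul_apply, smul_eq_mul]
        simp [ofReal, dif_neg hσ]
  · intro u σ
    by_cases h : (∑ z, (σ z : ℕ)) = M ^ 2 / 2
    · simp only [dif_pos h]; exact (hNpos u _).le
    · simp only [dif_neg h]; exact le_rfl
  · intro u σ h
    simp only [dif_pos h]
    exact hNpos u _
  · intro u σ h
    simp only [dif_neg h]
  · have : (fun u => lowestEnergyInSector 1 (Hxxz M u) 0) = Λ := funext fun u => (hΛE u).symm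
    rw [this]
    exact hΛ

/-! ### The condensate as a real quadratic form in the real amplitude -/

/-- The entries of `O = S⁺_tot S⁻_tot` are real. [folklore] -/
theorem otot_apply_im (σ τ : Config M) : (Otot M σ τ).im = 0 := by
  have h := (Complex.le_def.1 (condensate_apply_nonneg 1 σ τ)).2
  rw [Complex.zero_im] at h
  exact h.symm

/-- `Λ(ψ) = ψ ⬝ᵥ Oᵣ ψ` for a real amplitude `ψ`, `Oᵣ = (Re O_{στ})`. [folklore] -/
theorem lam_ofReal_eq_dotProduct (x : Config M → ℝ) :
    lam M (ofReal M x) = x ⬝ᵥ (Matrix.of fun σ τ : Config M => (Otot M σ τ).re) *ᵥ x := by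
  unfold lam
  rw [dotProduct, Complex.re_sum, dotProduct]
  refine Finset.sum_congr rfl fun σ _ => ?_
  have hstar : (star (ofReal M x)) σ = (x σ : ℂ) := by simp [ofReal, Complex.conj_ofReal]
  have hO : (Otot M *ᵥ ofReal M x) σ =
      ((((Matrix.of fun σ τ : Config M => (Otot M σ τ).re) *ᵥ x) σ : ℝ) : ℂ) := by
    rw [mulVec, dotProduct, mulVec, dotProduct]
    push_cast
    refine Finset.sum_congr rfl fun τ _ => ?_
    have hre : Otot M σ τ = (((Otot M σ τ).re : ℝ) : ℂ) :=
      Complex.ext (by simp) (by simp [otot_apply_im])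
    rw [of_apply, hre]
    simp [ofReal]
  rw [hstar, hO, ← Complex.ofReal_mul, Complex.ofReal_re]

/-- The local field in terms of `Oᵣ`: `Re(Oψ)(σ) = (Oᵣ ψ)(σ)` for a real amplitude. [bookkeeping] -/
theorem re_otot_mulVec_ofReal (x : Config M → ℝ) (σ : Config M) :
    ((Otot M *ᵥ ofReal M x) σ).re = ((Matrix.of fun σ τ : Config M => (Otot M σ τ).re) *ᵥ x) σ := by
  rw [mulVec, dotProduct, mulVec, dotProduct, Complex.re_sum]
  refine Finset.sum_congr rfl fun τ _ => ?_
  rw [of_apply, Complex.mul_re, otot_apply_im, zero_mul, sub_zero]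
  simp [ofReal]

/-- `Oᵣ` is a symmetric real matrix. [folklore] -/
theorem otot_re_isSymm : (Matrix.of fun σ τ : Config M => (Otot M σ τ).re).IsSymm := by
  ext σ τ
  simp only [transpose_apply, of_apply]
  unfold Otot
  rw [condensate_apply_symm]

/-- **`u ↦ Λ(Ψ u)` is `C^∞` along any `C^∞` family of real amplitudes** (a quadratic form). [folklore] -/
theorem contDiff_lam_family {Ψ : ℝ → Config M → ℝ} (hΨ : ContDiff ℝ ∞ Ψ) :
    ContDiff ℝ ∞ fun u => lam M (ofReal M (Ψ u)) := by
  have h : (fun u => lam M (ofReal M (Ψ u))) =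
      fun u => ∑ σ, ∑ τ, Ψ u σ * ((Otot M σ τ).re * Ψ u τ) := by
    funext u
    rw [lam_ofReal_eq_dotProduct]
    simp only [dotProduct, mulVec, of_apply, Finset.mul_sum]
  rw [h]
  refine ContDiff.sum fun σ _ => ContDiff.sum fun τ _ => ?_
  exact (contDiff_pi.1 hΨ σ).mul (contDiff_const.mul (contDiff_pi.1 hΨ τ))

/-- **Derivative of the condensate along a differentiable family of real amplitudes**:
`d/du Λ(Ψ u) = 2 ⟨Ψ', Oᵣ Ψ u⟩`. [folklore] -/
theorem hasDerivAt_lam_family {Ψ : ℝ → Config M → ℝ} {Ψ' : Config M → ℝ} {u : ℝ}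
    (hd : HasDerivAt Ψ Ψ' u) :
    HasDerivAt (fun v => lam M (ofReal M (Ψ v)))
      (2 * (Ψ' ⬝ᵥ (Matrix.of fun σ τ : Config M => (Otot M σ τ).re) *ᵥ Ψ u)) u := by
  have h : (fun v => lam M (ofReal M (Ψ v))) =
      fun v => Ψ v ⬝ᵥ (Matrix.of fun σ τ : Config M => (Otot M σ τ).re) *ᵥ Ψ v :=
    funext fun v => lam_ofReal_eq_dotProduct M (Ψ v)
  rw [h]
  exact hasDerivAt_quadraticForm_of_isSymm (otot_re_isSymm M) hd

/-- **H1 — the Doob–Hellmann–Feynman form of the derivative of the condensate.**  Along a differentiable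
family `Ψ` of real amplitudes vanishing off the half-filled configurations and non-zero on them,
`d/du Λ(Ψ u) = Σ_σ g_{Ψ u}(σ) · (2 Ψ u σ · Ψ' σ) = Σ_σ g(σ) ∂_u p_u(σ)` with the Doob–Johnson local field
`g = field M (Ψ u)` FROZEN and `p_u = (Ψ u)²` (the frozen-field term is the whole derivative:
`Σ_σ p(σ) ∂_u g(σ) = ⟨Ψ, OΨ'⟩ - ⟨OΨ, Ψ'⟩ = 0`).  Doob (1957); line card §Hardest. [folklore] -/
theorem hasDerivAt_lam_family_doob {Ψ : ℝ → Config M → ℝ} {Ψ' : Config M → ℝ} {u : ℝ}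
    (hd : HasDerivAt Ψ Ψ' u)
    (hoff : ∀ v σ, (∑ z, (σ z : ℕ)) ≠ M ^ 2 / 2 → Ψ v σ = 0)
    (hpos : ∀ σ, (∑ z, (σ z : ℕ)) = M ^ 2 / 2 → Ψ u σ ≠ 0) :
    HasDerivAt (fun v => lam M (ofReal M (Ψ v)))
      (∑ σ, field M (Ψ u) σ * (2 * Ψ u σ * Ψ' σ)) u := by
  refine (hasDerivAt_lam_family M hd).congr_deriv ?_
  rw [dotProduct, Finset.mul_sum]
  refine Finset.sum_congr rfl fun σ _ => ?_
  by_cases hσ : (∑ z, (σ z : ℕ)) = M ^ 2 / 2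
  · -- on the sector: `g(σ) · 2ΨΨ' = 2 Ψ' (OᵣΨ)(σ)`
    rw [field_eq, re_otot_mulVec_ofReal]
    field_simp [hpos σ hσ]
  · -- off the sector: the coordinate is constantly `0`, so `Ψ' σ = 0`
    have hcomp : HasDerivAt (fun v => Ψ v σ) (Ψ' σ) u := hasDerivAt_pi.1 hd σ
    have hzero : HasDerivAt (fun v => Ψ v σ) 0 u := by
      have : (fun v => Ψ v σ) = fun _ => (0:ℝ) := funext fun v => hoff v σ hσ
      rw [this]
      exact hasDerivAt_const u 0
    have hΨ' : Ψ' σ = 0 := hcomp.unique hzero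
    rw [hΨ', hoff u σ hσ]
    ring

end Summit.HubbardSuperconductivity.HubbardSuperconductivity.Theorems.AnisotropyChord.DoobJohnsonChord

end
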